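import Mathlib.RingTheory.RegularLocalRing.Defs
import Mathlib.RingTheory.Localization.AsSubring
import Mathlib.RingTheory.Localization.AtPrime.Basic
import Mathlib.RingTheory.Ideal.Height
import Mathlib.Algebra.CharP.Algebra
import Literature.NumberTheory.GaloisCohomology.KatoCohomologyPurity
import Literature.AlgebraicGeometry.Resolution.DivisorialPlace
import HarnessLib

/-!
# Gersten purity for the symbolic `H³_p`, transported to the pair presentation at `A_𝔮 ⊆ K`
# (crux `WildPurity.PurityTransfer`, line `birth`)

Stub `stub_gerstenTransport` of the lead's skeleton for crux stmt-ResolutionOfSingularities-17142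
(route `ResolutionOfSingularities/WildPurity`, Kato valuative purity above a resolvable affine
model).  The composition `PurityTransfer_of` reduces the crux to GERSTEN PURITY at the local ring
`A_𝔮` of a regular affine chart `A ⊆ K` (`𝔮` the centre of the valuation ring): a class of
`H³_p(K)` which is `A_P`-integral at every height-one prime `P ⊆ 𝔮` is `A_𝔮`-integral.  The tree
holds this as the NAMED FACT `Literature.NumberTheory.GaloisCohomology.Shiho2007_purity`
(Gros–Suwa 1988, Shiho 2007 Thm. 4.1, symbolic form), stated for an abstract regular local ring `A`
of characteristic `p` with fraction field `K` and Kato's group `KatoCohomologySymbolic p K n`; this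
file instantiates it (as the explicit hypothesis `hS`, never discharged here) at the regular local
ring `T := localizationIn K 𝔮 ⊆ K` (`= A_𝔮` realised inside `K`, Mathlib's
`Localization.subalgebra.ofField`) with `n = 2`, and moves the conclusion to the crux's pair
presentation `H3Pair p K` by `KatoCohomologySymbolic.mem_pairIntegral_iff`.

The instance plumbing: `T` is `IsLocalization.AtPrime T 𝔮`
(`Localization.subalgebra.isLocalization_ofField`), hence regular local by transport along
`IsLocalization.algEquiv 𝔮.primeCompl (Localization.AtPrime 𝔮) T` (`IsRegularLocalRing.of_ringEquiv`);
it is a domain with fraction field `K` (a subalgebra of the field `K = Frac A`); and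
`char T = char K = char k = p` (`charP_of_injective_algebraMap`, `RingHom.charP`).  The height-one
primes `P'` of `T` contract to height-one primes `P = P' ∩ A ⊆ 𝔮` of `A`
(`IsLocalization.height_under`; a prime of `T` meeting the units `A ∖ 𝔮` would be `⊤`), and
`A_P ⊆ T_{P'}` inside `K` (`localizationIn_under_subset_localizationIn`: `x * s = a` with `s ∉ P`
reads `x * s = a` in `T` with `s ∉ P'`), so `A_P`-integrality gives `T_{P'}`-integrality
(`integralSymbols_mono`), which is what the named fact consumes.
-/

noncomputable section

-- single-problem summit: the doubled namespace component `ResolutionOfSingularities` is forced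
set_option linter.dupNamespace false

open Literature.NumberTheory.GaloisCohomology
open Literature.NumberTheory.GaloisCohomology.KatoCohomologySymbolic

namespace Summit.ResolutionOfSingularities.ResolutionOfSingularities.Theorems.WildPurityPurityTransfer

/-- **`A_P ⊆ (A_𝔮)_{P'}` inside `K` for `P = P' ∩ A`.**  For a domain `B` with fraction field `K`,
a prime `𝔮` of `B`, `T := B_𝔮 ⊆ K` (`localizationIn K 𝔮`) and a prime `P'` of `T`, the local ring
of `B` at the contraction `P'.under B` is contained in the local ring of `T` at `P'` (both realised
inside `K`): if `x * s = a` with `a ∈ B`, `s ∈ B ∖ (P' ∩ B)`, then the same identity holds with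
`a, s` read in `T`, and `s ∉ P'`. [folklore] -/
theorem localizationIn_under_subset_localizationIn {B : Type*} [CommRing B] [IsDomain B]
    {K : Type*} [Field K] [Algebra B K] [IsFractionRing B K] (𝔮 : Ideal B) [𝔮.IsPrime]
    (P' : Ideal (localizationIn K 𝔮)) [P'.IsPrime] :
    (localizationIn K (P'.under B) : Set K) ⊆ (localizationIn K P' : Set K) := by
  intro x hx
  obtain ⟨a, s, hs, h⟩ := (mem_localizationIn_iff (P'.under B) x).1 hx
  exact (mem_localizationIn_iff P' x).2
    ⟨algebraMap B (localizationIn K 𝔮) a, algebraMap B (localizationIn K 𝔮) s, hs, h⟩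

/-- **Primes of `B_𝔮 ⊆ K` contract into `𝔮`.**  For `T := B_𝔮 ⊆ K` and a prime `P'` of `T`,
`P' ∩ B ⊆ 𝔮`: an element of `B ∖ 𝔮` becomes a unit in `T`, and a prime contains no unit.
[folklore] -/
theorem under_localizationIn_le {B : Type*} [CommRing B] [IsDomain B]
    {K : Type*} [Field K] [Algebra B K] [IsFractionRing B K] (𝔮 : Ideal B) [𝔮.IsPrime]
    (P' : Ideal (localizationIn K 𝔮)) [hP' : P'.IsPrime] : P'.under B ≤ 𝔮 := by
  intro x hx
  by_contra hx𝔮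
  exact hP'.ne_top (P'.eq_top_of_isUnit_mem hx
    (IsLocalization.map_units (localizationIn K 𝔮) (⟨x, hx𝔮⟩ : 𝔮.primeCompl)))

/-- **STUB `stub_gerstenTransport` (crux `PurityTransfer`, line `birth`)** — the named fact
`Shiho2007_purity` (Gersten purity for Kato's `H^{n+1}_p` over regular local rings of
characteristic `p`: `⋂_{ht P = 1} Unr(A_P) ≤ Unr(A)`), transported to the crux's pair presentation
of `H³_p(K)` at the local ring `A_𝔮 ⊆ K` of an affine model: assuming `Shiho2007_purity.{0}`, for
`p` prime, `k` of characteristic `p`, `A ⊆ K` a `k`-subalgebra with `Frac A = K` and `𝔮` a prime of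
`A` with `A_𝔮` regular, a class `α ∈ H³_p(K)` (`H3Pair p K`) that is `A_P`-integral
(`pairIntegral p ↑(A_P)`) for every height-one prime `P ⊆ 𝔮` is `A_𝔮`-integral.  Proof: apply the
fact to the regular local ring `T := A_𝔮 ⊆ K` (`IsLocalization.AtPrime T 𝔮`, regularity transported
from `Localization.AtPrime 𝔮`, `char T = p`, `Frac T = K`) with `n = 2`; its height-one primes `P'`
contract to height-one primes `P' ∩ A ⊆ 𝔮` (`IsLocalization.height_under`) with
`A_{P' ∩ A} ⊆ T_{P'}`, so the hypothesis feeds it (`integralSymbols_mono`), and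
`mem_pairIntegral_iff` translates between `H3Pair p K` and `KatoCohomologySymbolic p K 2` on both
sides. [cite: Shiho2007, Thm. 4.1] -/
theorem stub_gerstenTransport (hS : Shiho2007_purity.{0}) (p : ℕ) (hp : p.Prime) (k K : Type)
    [Field k] [CharP k p] [Field K] [Algebra k K] (A : Subalgebra k K) [IsFractionRing A K]
    (𝔮 : Ideal A) [𝔮.IsPrime] (hreg : IsRegularLocalRing (Localization.AtPrime 𝔮))
    (α : H3Pair p K)
    (hα : ∀ (P : Ideal A) [P.IsPrime], P.height = 1 → P ≤ 𝔮 →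
      α ∈ pairIntegral p (localizationIn K P : Set K)) :
    α ∈ pairIntegral p (localizationIn K 𝔮 : Set K) := by
  haveI : IsLocalization.AtPrime (localizationIn K 𝔮) 𝔮 :=
    Localization.subalgebra.isLocalization_ofField K 𝔮.primeCompl 𝔮.primeCompl_le_nonZeroDivisors
  haveI := hreg
  haveI : IsRegularLocalRing (localizationIn K 𝔮) :=
    IsRegularLocalRing.of_ringEquiv
      (IsLocalization.algEquiv 𝔮.primeCompl (Localization.AtPrime 𝔮)
        (localizationIn K 𝔮)).toRingEquiv
  haveI : CharP K p := charP_of_injective_algebraMap (algebraMap k K).injective p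
  haveI : CharP (localizationIn K 𝔮) p :=
    (algebraMap (localizationIn K 𝔮) K).charP Subtype.val_injective p
  have h1 : heightOneIntegralSymbols p 2 (localizationIn K 𝔮) K ≤
      integralSymbols p 2 (Set.range (algebraMap (localizationIn K 𝔮) K)) :=
    hS p hp (localizationIn K 𝔮) K 2
  have hrange : Set.range (algebraMap (localizationIn K 𝔮) K) = (localizationIn K 𝔮 : Set K) :=
    Subtype.range_val
  rw [hrange] at h1
  refine (mem_pairIntegral_iff p _ α).2
    (h1 ((mem_heightOneIntegralSymbols_iff _).2 fun P' _ hP' => ?_))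
  have hP1 : (P'.under A).height = 1 := by
    rw [IsLocalization.height_under 𝔮.primeCompl P']
    exact hP'
  exact integralSymbols_mono p (localizationIn_under_subset_localizationIn 𝔮 P')
    ((mem_pairIntegral_iff p _ α).1 (hα (P'.under A) hP1 (under_localizationIn_le 𝔮 P')))

end Summit.ResolutionOfSingularities.ResolutionOfSingularities.Theorems.WildPurityPurityTransfer

end
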